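import Summits.QuantumFields.BalabanUV.Beta.GAN24.OneStepConstraintAxialLocalisation
import Summits.QuantumFields.BalabanUV.Beta.GAN24.FluctuationCovarianceRateTransfer

/-!
# `BalabanUV.Beta.GAN24.OneStepConstraintAxialRate` — binder row G-an2-4 ∕ (CONV-C), routes C-R6° («VALUES») × R7 («TWO CURRENCIES»), PART 182:
# THE RATE HALF FOR THE STACKED ONE-STEP CONSTRAINT `Q_ax = fromRows (re QB N R M) E` AT A FIXED LATTICE — the gauge-fixed blocks `𝒮`, `ℋ`, `𝒢 = flucCov H Q_ax` are LIPSCHITZ IN THE FINE FORM,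
# entrywise with decay: two fine forms `H, H′` with PART 180's letters (symmetric, `0 ≤ ⟨u,·u⟩ ≤ h|u|²`, entries `≤ h₀e^{−δ_H·tdist(par x, par x′)}`, a common coercivity `γ_K` of the two
# regularised forms) and the RATE letter `|(H − H′)(x,x′)| ≤ ε·e^{−δ_H·tdist(par x, par x′)}` ⟹ `|(𝒮 − 𝒮′)(b,b′)|`, `|(ℋ′ − ℋ)(x,b)|`, `|(𝒢′ − 𝒢)(x,x′)|` are `≤ (const)·ε·e^{−(rate)·(distance)}`,
# LINEAR in `ε` — PARTs 107 ∕ 113 ∕ 114 at `Qf = 1` with PART 180's letters (PART 172's pattern for the stacked constraint) — census V200″ (δ), (SR) half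
# (unit b2b-balaban-gan24-p3, gen 60; v1)

NOT IN PRINT; OUR PROOF ([folklore] composition BY NAME: PART 107 `EffectiveFormRateTransfer.abs_inv_sub_inv_le` (second resolvent identity with decay) on the fine gauge, PART 113
`BlockRatesFromSoftResolvent.abs_effForm_sub_le_of_soft ∕ abs_avg_minOp_sub_le_of_soft` and PART 114 `FluctuationCovarianceRateTransfer.abs_avg_flucCov_sub_le_of_soft` at the trivial finer
averaging `Qf = 1`, with every constraint-side letter from PART 180 (`OneStepConstraintAxialGauges`: `isPseudoDist_key`, `sumBound_key`, `sum_exp_sigma_key_le`, `sum_abs_fromRows_row`,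
`tdist_key_le_tdist_par_add_two`, `tdist_par_key_le_tdist_par_add_one`, `abs_regFormAx_apply_le`; `OneStepConstraintAxialLocalisation`: `ub_QB_axial`, `abs_blockProp_le_QB_axial`,
`abs_inv_mul_transpose_le_QB_axial`) and PART 170's fine gauge (`isPseudoDist_fine`, `sumBound_fine`).  [B9] Thm 3.1 ∕ [King1986] Lemma 4.5 (4.38) are the printed CLASS of such statements;
nothing printed is a hypothesis.)
HONEST FRAMING (cell contract, verbatim): «discharging `BetaPertH` makes Bałaban's UV stability UNCONDITIONAL — a real constructive-QFT result; it is NOT the continuum limit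
and NOT the Clay problem.»  HONEST DEPENDENCY (verbatim): «continuum YM on T⁴ ⇐ BetaPertH ∧ nine spine estimates (0/9 proved); BetaPertH ⇐ (D1) ∧ (D4) ∧ CAP+tail; G-an2-4 gates
asym, D1 and NE2/3/4.»

WHY (census V200″ (δ)).  In the gauge-fixed one-loop step the stacked constraint `Q_ax` and its lattice are the SAME at every level `k`; only the fine form changes (`H_k = re Δ_k`).  PART 180
transfers the k-uniform decay (UD) to `𝒢_k = flucCov H_k Q_ax`; THIS FILE transfers the STEP RATE (SR): feed `ε = |H_k − H_{k′}|`'s amplitude and read `|𝒢_k − 𝒢_{k′}| ≤ (const)·ε·e^{−(rate)·D}`.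
The instantiation `H = re Δ_n`, `H′ = re Δ_m` with NE2 ∕ pv09's (1.66) strip-rate letter `StepCovarianceInputs.abs_reDelK_sub_le` (`ε = C·n⁻²`) is the next PART.

THE GAUGES AND CONSTANTS: as PART 180 (`key = Sum.elim (·.1) (par ∘ ι)` spelled inline; `ρ`, `D`, `σ`; `γ_K` an INPUT common to `K, K′`; `c_K`, `r_F`, `e₂ = 4R^{2d}(1+R^{−d}) + 2·1`, `Λ = h·e₂`),
plus `r = r_F∕2` (every decay input read at the WEAKER rate `r`), `c₀ = (2∕γ_K)e^{2r_F}`, `c₁ = (2∕γ_K)e^{r_F}`, the soft one-step amplitude `ε_E = (2∕γ_K)²·ε·(d·R^d·Kf(r_F∕2))²`,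
`r_U′ = rate (s ↦ d(1+R^d)·Kf s) (Λ+a)⁻¹ c₀ r`.
WHAT THIS FILE PROVES (0 sorry, 0 `def`; `N, R ≥ 1`, every torus `M`, every `d`, every finite `T` with `ι : T ↪ Tor (fine (R·N) M) × Fin d` avoiding the top corners):
* §1 **`abs_inv_sub_inv_regFormAx_le`** — THE SOFT ONE-STEP LETTER: `|(K′⁻¹ − K⁻¹)(x,x′)| ≤ ε_E·e^{−r·tdist(par x, par x′)}` (the stacked regulariser cancels in `K − K′ = H − H′`);
  `abs_blockProp_le_QB_axial_half`, `abs_inv_mul_transpose_le_QB_axial_half` (PART 180's two unit letters read at rate `r`).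
* §2 **`abs_effForm_sub_le_QB_axial`** (`|(𝒮 − 𝒮′)(b,b′)| ≤ 4(Λ+a)²·(1²·ε_E·e^{2r})·(d(1+R^d)Kf(r_U′∕2))²·e^{−(r_U′∕2)·tdist(key b, key b′)}`), **`abs_minOp_sub_le_QB_axial`**
  (`|(ℋ′ − ℋ)(x,b)| ≤ …·e^{−(m′∕2)·σ}`, `m′ = min r (r_U′∕2)`), **`abs_flucCov_sub_le_QB_axial`** (`|(𝒢′ − 𝒢)(x,x′)| ≤ (ε_E + …)·e^{−(m′∕4)·tdist(par x, par x′)}`) — every term carries a factor `ε`.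
WHAT IT IS NOT: no model-side letter is discharged here (PART 181 ∕ the next PART do that for `H = re Δ_k`); ONE lattice; EL₂ untouched.  SUPPLIER work; NEVER «G-an2-4 closed»; NOT (CONV-C),
NOT D1, NOT `BetaPertH`, NOT continuum, NOT Clay.  Records: `HOME/b2b-balaban-gan24-p3/gen60/README.md`.
-/

noncomputable section

open scoped BigOperators Matrix
open Finset Matrix

namespace Summit.QuantumFields.BalabanUV.Beta.GAN24.OneStepConstraintAxialRate

open Literature.MathematicalPhysics.QuantumFieldTheory.Balaban1983to89
open Literature.MathematicalPhysics.QuantumFieldTheory.Balaban1983to89.B4Sect5Torus (IsPseudoDist SumBound rate rate_pos)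
open Literature.MathematicalPhysics.QuantumFieldTheory.Balaban1983to89.Beta.Composition (blockProp)
open Literature.MathematicalPhysics.QuantumFieldTheory.Balaban1983to89.Beta.CompositionSingular (effForm minOp flucCov)
open Literature.MathematicalPhysics.QuantumFieldTheory.Balaban1983to89.B5Prop11Plancherel (Tor fine)
open Literature.MathematicalPhysics.QuantumFieldTheory.Balaban1983to89.B5RealFields (reM)
open Literature.MathematicalPhysics.QuantumFieldTheory.Balaban1983to89.Beta.VectorTailsCov (tdist tdist_triangle tdist_comm)
open Summit.QuantumFields.BalabanUV.T4Continuum.BalabanLineAverage (QB)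
open Summit.QuantumFields.BalabanUV.T4Continuum.BalabanAveragedTowerModes (par rem)
open Summit.QuantumFields.BalabanUV.Beta.GAN24.EffectiveFormLocalisation (transpose_reg)
open Summit.QuantumFields.BalabanUV.Beta.GAN24.EffectiveFormRateTransfer (abs_inv_sub_inv_le)
open Summit.QuantumFields.BalabanUV.Beta.GAN24.BlockRatesFromSoftResolvent (abs_effForm_sub_le_of_soft abs_avg_minOp_sub_le_of_soft)
open Summit.QuantumFields.BalabanUV.Beta.GAN24.FluctuationCovarianceRateTransfer (abs_avg_flucCov_sub_le_of_soft)
open Summit.QuantumFields.BalabanUV.Beta.GAN24.OneStepConstraintLocalisation (isPseudoDist_fine sumBound_fine)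
open Summit.QuantumFields.BalabanUV.Beta.GAN24.OneStepConstraintAxialGauges (isPseudoDist_key sumBound_key sum_exp_sigma_key_le sum_abs_fromRows_row tdist_key_le_tdist_par_add_two
  tdist_par_key_le_tdist_par_add_one abs_regFormAx_apply_le)
open Summit.QuantumFields.BalabanUV.Beta.GAN24.OneStepConstraintAxialLocalisation (ub_QB_axial abs_blockProp_le_QB_axial abs_inv_mul_transpose_le_QB_axial)

variable {d : ℕ} (N R : ℕ) [NeZero N] [NeZero R] (M : Fin d → ℕ) [hM : ∀ μ, NeZero (M μ)]
variable {T : Type*} [Fintype T] [DecidableEq T] (ι : T ↪ Tor (fine (R * N) M) × Fin d)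

variable {H H' : Matrix (Tor (fine (R * N) M) × Fin d) (Tor (fine (R * N) M) × Fin d) ℝ} {Kf : ℝ → ℝ}

/-! ## §1 The soft one-step letter `E = K′⁻¹ − K⁻¹` and the two unit letters at the half rate -/

section Soft

/-- **`abs_inv_sub_inv_regFormAx_le` — THE SOFT ONE-STEP LETTER FOR THE STACKED CONSTRAINT** [our proof; PART 107 `abs_inv_sub_inv_le` on the fine gauge with the common coercivity `γ_K` (INPUT)
and PART 180's entry bound, the stacked regulariser cancelling in `K − K′`]: `|(K′⁻¹ − K⁻¹)(x,x′)| ≤ (2∕γ_K)²·ε·(d·R^d·Kf(r_F∕2))²·e^{−(r_F∕2)·tdist(par x, par x′)}`. -/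
theorem abs_inv_sub_inv_regFormAx_le (hKf0 : ∀ s : ℝ, 0 < s → 0 ≤ Kf s)
    (hKf : ∀ s : ℝ, 0 < s → ∀ y : Tor (fine N M), ∑ y' : Tor (fine N M), Real.exp (-(s * (tdist y y' : ℝ))) ≤ Kf s)
    (hH : Hᵀ = H) (hH' : H'ᵀ = H') {γK : ℝ} (hγK : 0 < γK) {a h₀ δH : ℝ} (ha : 0 < a) (hh₀ : 0 ≤ h₀) (hδH : 0 < δH)
    (hK : QGQInverse.Coercive (H + (Matrix.fromRows (reM (QB N R M)) (fun (t : T) (x : Tor (fine (R * N) M) × Fin d) => if x = ι t then (1 : ℝ) else 0))ᵀ * (a • (1 : Matrix ((Tor (fine N M) × Fin d) ⊕ T) ((Tor (fine N M) × Fin d) ⊕ T) ℝ)) * Matrix.fromRows (reM (QB N R M)) (fun (t : T) (x : Tor (fine (R * N) M) × Fin d) => if x = ι t then (1 : ℝ) else 0)) γK) (hK' : QGQInverse.Coercive (H' + (Matrix.fromRows (reM (QB N R M)) (fun (t : T) (x : Tor (fine (R * N) M) × Fin d) => if x = ι t then (1 : ℝ) else 0))ᵀ * (a • (1 : Matrix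 ((Tor (fine N M) × Fin d) ⊕ T) ((Tor (fine N M) × Fin d) ⊕ T) ℝ)) * Matrix.fromRows (reM (QB N R M)) (fun (t : T) (x : Tor (fine (R * N) M) × Fin d) => if x = ι t then (1 : ℝ) else 0)) γK)
    (hHent : ∀ x x', |H x x'| ≤ h₀ * Real.exp (-(δH * (tdist (par N R M x.1) (par N R M x'.1) : ℝ))))
    (hHent' : ∀ x x', |H' x x'| ≤ h₀ * Real.exp (-(δH * (tdist (par N R M x.1) (par N R M x'.1) : ℝ)))) {ε : ℝ} (hε : 0 ≤ ε)
    (hdiff : ∀ x x', |(H - H') x x'| ≤ ε * Real.exp (-(δH * (tdist (par N R M x.1) (par N R M x'.1) : ℝ))))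
    {cK rF : ℝ} (hcK : cK = (h₀ + a * (((R : ℝ) ^ d)⁻¹ * ((R : ℝ) ^ d)⁻¹) * Real.exp (2 * δH)) + a)
    (hrF : rF = rate (fun s => (d : ℝ) * (R : ℝ) ^ d * Kf s) γK cK δH)
    (x x' : Tor (fine (R * N) M) × Fin d) :
    |(((H' + (Matrix.fromRows (reM (QB N R M)) (fun (t : T) (x : Tor (fine (R * N) M) × Fin d) => if x = ι t then (1 : ℝ) else 0))ᵀ * (a • (1 : Matrix ((Tor (fine N M) × Fin d) ⊕ T) ((Tor (fine N M) × Fin d) ⊕ T) ℝ)) * Matrix.fromRows (reM (QB N R M)) (fun (t : T) (x : Tor (fine (R * N) M) × Fin d) => if x = ι t then (1 : ℝ) else 0)))⁻¹ - ((H + (Matrix.fromRows (reM (QB N R M)) (fun (t : T) (x : Tor (fine (R * N) M) × Fin d) => if x = ι t then (1 : ℝ) else 0))ᵀ * (a • (1 : Matrix ((Tor (fine N M) × Fin d) ⊕ T) ((Tor (fine N M) × Fin d) ⊕ T) ℝ)) * Matrix.fromRows (reM (QB N R M)) (fun (t : T) (x : Tor (fine (R * N) M) × Fin d) => if x = ι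 t then (1 : ℝ) else 0)))⁻¹) x x'| ≤
      (2 / γK) ^ 2 * ε * ((d : ℝ) * (R : ℝ) ^ d * Kf (rF / 2)) ^ 2 * Real.exp (-(rF / 2 * (tdist (par N R M x.1) (par N R M x'.1) : ℝ))) := by
  have hcK0 : 0 ≤ cK := by rw [hcK]; positivity
  have hprof : ∀ s : ℝ, 0 < s → 0 ≤ (d : ℝ) * (R : ℝ) ^ d * Kf s := fun s hs => by have := hKf0 s hs; positivity
  have hA : ∀ p q, |(H + (Matrix.fromRows (reM (QB N R M)) (fun (t : T) (x : Tor (fine (R * N) M) × Fin d) => if x = ι t then (1 : ℝ) else 0))ᵀ * (a • (1 : Matrix ((Tor (fine N M) × Fin d) ⊕ T) ((Tor (fine N M) × Fin d) ⊕ T) ℝ)) * Matrix.fromRows (reM (QB N R M)) (fun (t : T) (x : Tor (fine (R * N) M) × Fin d) => if x = ι t then (1 : ℝ) else 0)) p q| ≤ cK * Real.exp (-(δH * (tdist (par N R M p.1) (par N R M q.1) : ℝ))) := fun p q => by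
    rw [hcK]; exact abs_regFormAx_apply_le N R M ι ha.le hδH.le hHent p q
  have hA' : ∀ p q, |(H' + (Matrix.fromRows (reM (QB N R M)) (fun (t : T) (x : Tor (fine (R * N) M) × Fin d) => if x = ι t then (1 : ℝ) else 0))ᵀ * (a • (1 : Matrix ((Tor (fine N M) × Fin d) ⊕ T) ((Tor (fine N M) × Fin d) ⊕ T) ℝ)) * Matrix.fromRows (reM (QB N R M)) (fun (t : T) (x : Tor (fine (R * N) M) × Fin d) => if x = ι t then (1 : ℝ) else 0)) p q| ≤ cK * Real.exp (-(δH * (tdist (par N R M p.1) (par N R M q.1) : ℝ))) := fun p q => by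
    rw [hcK]; exact abs_regFormAx_apply_le N R M ι ha.le hδH.le hHent' p q
  have hd : ∀ p q, |((H + (Matrix.fromRows (reM (QB N R M)) (fun (t : T) (x : Tor (fine (R * N) M) × Fin d) => if x = ι t then (1 : ℝ) else 0))ᵀ * (a • (1 : Matrix ((Tor (fine N M) × Fin d) ⊕ T) ((Tor (fine N M) × Fin d) ⊕ T) ℝ)) * Matrix.fromRows (reM (QB N R M)) (fun (t : T) (x : Tor (fine (R * N) M) × Fin d) => if x = ι t then (1 : ℝ) else 0)) -
      (H' + (Matrix.fromRows (reM (QB N R M)) (fun (t : T) (x : Tor (fine (R * N) M) × Fin d) => if x = ι t then (1 : ℝ) else 0))ᵀ * (a • (1 : Matrix ((Tor (fine N M) × Fin d) ⊕ T) ((Tor (fine N M) × Fin d) ⊕ T) ℝ)) * Matrix.fromRows (reM (QB N R M)) (fun (t : T) (x : Tor (fine (R * N) M) × Fin d) => if x = ι t then (1 : ℝ) else 0))) p q| ≤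
      ε * Real.exp (-(δH * (tdist (par N R M p.1) (par N R M q.1) : ℝ))) := fun p q => by
    rw [add_sub_add_right_eq_sub]; exact hdiff p q
  have hmain := abs_inv_sub_inv_le hprof (isPseudoDist_fine N R M) (sumBound_fine N R M hKf) (transpose_reg hH a) (transpose_reg hH' a)
    hγK hcK0 hδH hε hK hK' hA hA' hd x x'
  rw [← hrF, Matrix.sub_apply] at hmain
  rwa [Matrix.sub_apply, abs_sub_comm]

/-- PART 180's stacked block-propagator letter read at the half rate `r_F∕2`. [folklore] -/
theorem abs_blockProp_le_QB_axial_half (hKf0 : ∀ s : ℝ, 0 < s → 0 ≤ Kf s)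
    (hKf : ∀ s : ℝ, 0 < s → ∀ y : Tor (fine N M), ∑ y' : Tor (fine N M), Real.exp (-(s * (tdist y y' : ℝ))) ≤ Kf s)
    (hH : Hᵀ = H) {γK : ℝ} (hγK : 0 < γK) {a h₀ δH : ℝ} (ha : 0 < a) (hh₀ : 0 ≤ h₀) (hδH : 0 < δH)
    (hK : QGQInverse.Coercive (H + (Matrix.fromRows (reM (QB N R M)) (fun (t : T) (x : Tor (fine (R * N) M) × Fin d) => if x = ι t then (1 : ℝ) else 0))ᵀ * (a • (1 : Matrix ((Tor (fine N M) × Fin d) ⊕ T) ((Tor (fine N M) × Fin d) ⊕ T) ℝ)) * Matrix.fromRows (reM (QB N R M)) (fun (t : T) (x : Tor (fine (R * N) M) × Fin d) => if x = ι t then (1 : ℝ) else 0)) γK)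
    (hHent : ∀ x x', |H x x'| ≤ h₀ * Real.exp (-(δH * (tdist (par N R M x.1) (par N R M x'.1) : ℝ))))
    {cK rF c₀ : ℝ} (hcK : cK = (h₀ + a * (((R : ℝ) ^ d)⁻¹ * ((R : ℝ) ^ d)⁻¹) * Real.exp (2 * δH)) + a)
    (hrF : rF = rate (fun s => (d : ℝ) * (R : ℝ) ^ d * Kf s) γK cK δH) (hc₀ : c₀ = 2 / γK * Real.exp (2 * rF)) (b b' : (Tor (fine N M) × Fin d) ⊕ T) :
    |blockProp (H + (Matrix.fromRows (reM (QB N R M)) (fun (t : T) (x : Tor (fine (R * N) M) × Fin d) => if x = ι t then (1 : ℝ) else 0))ᵀ * (a • (1 : Matrix ((Tor (fine N M) × Fin d) ⊕ T) ((Tor (fine N M) × Fin d) ⊕ T) ℝ)) * Matrix.fromRows (reM (QB N R M)) (fun (t : T) (x : Tor (fine (R * N) M) × Fin d) => if x = ι t then (1 : ℝ) else 0)) (Matrix.fromRows (reM (QB N R M)) (fun (t : T) (x : Tor (fine (R * N) M) × Fin d) => if x = ι t then (1 : ℝ) else 0)) b b'| ≤ c₀ * Real.exp (-(rF / 2 *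 (tdist ((Sum.elim (fun b : Tor (fine N M) × Fin d => b.1) (fun t : T => par N R M (ι t).1)) b) ((Sum.elim (fun b : Tor (fine N M) × Fin d => b.1) (fun t : T => par N R M (ι t).1)) b') : ℝ))) := by
  have hcK0 : 0 ≤ cK := by rw [hcK]; positivity
  have hprof : ∀ s : ℝ, 0 < s → 0 ≤ (d : ℝ) * (R : ℝ) ^ d * Kf s := fun s hs => by have := hKf0 s hs; positivity
  have hrF0 : 0 < rF := by rw [hrF]; exact rate_pos hprof hγK hcK0 hδH
  have hc₀0 : 0 ≤ c₀ := by rw [hc₀]; positivity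
  refine (abs_blockProp_le_QB_axial N R M ι hKf0 hKf hH hγK ha hh₀ hδH hK hHent hcK hrF hc₀ b b').trans (mul_le_mul_of_nonneg_left (Real.exp_le_exp.mpr ?_) hc₀0)
  have h0 : (0 : ℝ) ≤ (tdist ((Sum.elim (fun b : Tor (fine N M) × Fin d => b.1) (fun t : T => par N R M (ι t).1)) b) ((Sum.elim (fun b : Tor (fine N M) × Fin d => b.1) (fun t : T => par N R M (ι t).1)) b') : ℝ) := Nat.cast_nonneg _
  nlinarith

/-- PART 180's stacked soft-column letter read at the half rate `r_F∕2`. [folklore] -/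
theorem abs_inv_mul_transpose_le_QB_axial_half (hKf0 : ∀ s : ℝ, 0 < s → 0 ≤ Kf s)
    (hKf : ∀ s : ℝ, 0 < s → ∀ y : Tor (fine N M), ∑ y' : Tor (fine N M), Real.exp (-(s * (tdist y y' : ℝ))) ≤ Kf s)
    (hH : Hᵀ = H) {γK : ℝ} (hγK : 0 < γK) {a h₀ δH : ℝ} (ha : 0 < a) (hh₀ : 0 ≤ h₀) (hδH : 0 < δH)
    (hK : QGQInverse.Coercive (H + (Matrix.fromRows (reM (QB N R M)) (fun (t : T) (x : Tor (fine (R * N) M) × Fin d) => if x = ι t then (1 : ℝ) else 0))ᵀ * (a • (1 : Matrix ((Tor (fine N M) × Fin d) ⊕ T) ((Tor (fine N M) × Fin d) ⊕ T) ℝ)) * Matrix.fromRows (reM (QB N R M)) (fun (t : T) (x : Tor (fine (R * N) M) × Fin d) => if x = ι t then (1 : ℝ) else 0)) γK)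
    (hHent : ∀ x x', |H x x'| ≤ h₀ * Real.exp (-(δH * (tdist (par N R M x.1) (par N R M x'.1) : ℝ))))
    {cK rF c₁ : ℝ} (hcK : cK = (h₀ + a * (((R : ℝ) ^ d)⁻¹ * ((R : ℝ) ^ d)⁻¹) * Real.exp (2 * δH)) + a)
    (hrF : rF = rate (fun s => (d : ℝ) * (R : ℝ) ^ d * Kf s) γK cK δH) (hc₁ : c₁ = 2 / γK * Real.exp rF) (x : Tor (fine (R * N) M) × Fin d) (b : (Tor (fine N M) × Fin d) ⊕ T) :
    |(((H + (Matrix.fromRows (reM (QB N R M)) (fun (t : T) (x : Tor (fine (R * N) M) × Fin d) => if x = ι t then (1 : ℝ) else 0))ᵀ * (a • (1 : Matrix ((Tor (fine N M) × Fin d) ⊕ T) ((Tor (fine N M) × Fin d) ⊕ T) ℝ)) * Matrix.fromRows (reM (QB N R M)) (fun (t : T) (x : Tor (fine (R * N) M) × Fin d) => if x = ι t then (1 : ℝ) else 0)))⁻¹ * (Matrix.fromRows (reM (QB N R M)) (fun (t : T) (x : Tor (fine (R * N) M) × Fin d) => if x = ι t then (1 : ℝ) else 0))ᵀ) x b| ≤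 c₁ * Real.exp (-(rF / 2 * (tdist (par N R M x.1) ((Sum.elim (fun b : Tor (fine N M) × Fin d => b.1) (fun t : T => par N R M (ι t).1)) b) : ℝ))) := by
  have hcK0 : 0 ≤ cK := by rw [hcK]; positivity
  have hprof : ∀ s : ℝ, 0 < s → 0 ≤ (d : ℝ) * (R : ℝ) ^ d * Kf s := fun s hs => by have := hKf0 s hs; positivity
  have hrF0 : 0 < rF := by rw [hrF]; exact rate_pos hprof hγK hcK0 hδH
  have hc₁0 : 0 ≤ c₁ := by rw [hc₁]; positivity
  refine (abs_inv_mul_transpose_le_QB_axial N R M ι hKf0 hKf hH hγK ha hh₀ hδH hK hHent hcK hrF hc₁ x b).trans (mul_le_mul_of_nonneg_left (Real.exp_le_exp.mpr ?_) hc₁0)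
  have h0 : (0 : ℝ) ≤ (tdist (par N R M x.1) ((Sum.elim (fun b : Tor (fine N M) × Fin d => b.1) (fun t : T => par N R M (ι t).1)) b) : ℝ) := Nat.cast_nonneg _
  nlinarith

end Soft

/-! ## §2 The three RATE ENDs (PARTs 113 ∕ 114 at `Qf = 1`) -/

section Ends

/-- **`abs_effForm_sub_le_QB_axial` — THE GAUGE-FIXED EFFECTIVE FORM IS LIPSCHITZ IN THE FINE FORM, ENTRYWISE WITH DECAY** [our proof; PART 113 `abs_effForm_sub_le_of_soft` at `Qf = 1` with §1's
soft one-step letter and PART 180's constraint letters]: `|(𝒮 − 𝒮′)(b,b′)| ≤ 4(Λ+a)²·(1²·ε_E·e^{r·2})·(d(1+R^d)Kf(r_U′∕2))²·e^{−(r_U′∕2)·tdist(key b, key b′)}`. -/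
theorem abs_effForm_sub_le_QB_axial (hι : ∀ t : T, ¬ (∀ ν, ((rem N R M (ι t).1 ν : ℕ)) = R - 1)) (hKf0 : ∀ s : ℝ, 0 < s → 0 ≤ Kf s)
    (hKf : ∀ s : ℝ, 0 < s → ∀ y : Tor (fine N M), ∑ y' : Tor (fine N M), Real.exp (-(s * (tdist y y' : ℝ))) ≤ Kf s)
    (hH : Hᵀ = H) (hpsd : ∀ z, 0 ≤ z ⬝ᵥ (H *ᵥ z)) (hH' : H'ᵀ = H') (hpsd' : ∀ z, 0 ≤ z ⬝ᵥ (H' *ᵥ z)) {h : ℝ} (hh : 0 ≤ h)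
    (hHub : ∀ u, u ⬝ᵥ (H *ᵥ u) ≤ h * (u ⬝ᵥ u)) (hHub' : ∀ u, u ⬝ᵥ (H' *ᵥ u) ≤ h * (u ⬝ᵥ u)) {γK : ℝ} (hγK : 0 < γK)
    {a h₀ δH : ℝ} (ha : 0 < a) (hh₀ : 0 ≤ h₀) (hδH : 0 < δH)
    (hK : QGQInverse.Coercive (H + (Matrix.fromRows (reM (QB N R M)) (fun (t : T) (x : Tor (fine (R * N) M) × Fin d) => if x = ι t then (1 : ℝ) else 0))ᵀ * (a • (1 : Matrix ((Tor (fine N M) × Fin d) ⊕ T) ((Tor (fine N M) × Fin d) ⊕ T) ℝ)) * Matrix.fromRows (reM (QB N R M)) (fun (t : T) (x : Tor (fine (R * N) M) × Fin d) => if x = ι t then (1 : ℝ) else 0)) γK) (hK' : QGQInverse.Coercive (H' + (Matrix.fromRows (reM (QB N R M)) (fun (t : T) (x : Tor (fine (R * N) M) × Fin d) => if x = ι t then (1 : ℝ) else 0))ᵀ * (a • (1 : Matrix ((Tor (fine N M) × Fin d) ⊕ T) ((Tor (fine N M) × Fin d) ⊕ T) ℝ)) * Matrix.fromRows (reM (QB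 N R M)) (fun (t : T) (x : Tor (fine (R * N) M) × Fin d) => if x = ι t then (1 : ℝ) else 0)) γK)
    (hHent : ∀ x x', |H x x'| ≤ h₀ * Real.exp (-(δH * (tdist (par N R M x.1) (par N R M x'.1) : ℝ))))
    (hHent' : ∀ x x', |H' x x'| ≤ h₀ * Real.exp (-(δH * (tdist (par N R M x.1) (par N R M x'.1) : ℝ)))) {ε : ℝ} (hε : 0 ≤ ε)
    (hdiff : ∀ x x', |(H - H') x x'| ≤ ε * Real.exp (-(δH * (tdist (par N R M x.1) (par N R M x'.1) : ℝ))))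
    {cK rF r c₀ Λ εE rU' : ℝ} (hcK : cK = (h₀ + a * (((R : ℝ) ^ d)⁻¹ * ((R : ℝ) ^ d)⁻¹) * Real.exp (2 * δH)) + a)
    (hrF : rF = rate (fun s => (d : ℝ) * (R : ℝ) ^ d * Kf s) γK cK δH)
    (hr : r = rF / 2) (hc₀ : c₀ = 2 / γK * Real.exp (2 * rF)) (hΛ : Λ = h * (4 * ((R : ℝ) ^ d) ^ 2 * (1 + ((R : ℝ) ^ d)⁻¹) + 2 * 1))
    (hεE : εE = (2 / γK) ^ 2 * ε * ((d : ℝ) * (R : ℝ) ^ d * Kf (rF / 2)) ^ 2) (hrU' : rU' = rate (fun s => (d : ℝ) * (1 + (R : ℝ) ^ d) * Kf s) (Λ + a)⁻¹ c₀ r)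
    (b b' : (Tor (fine N M) × Fin d) ⊕ T) :
    |(effForm H (Matrix.fromRows (reM (QB N R M)) (fun (t : T) (x : Tor (fine (R * N) M) × Fin d) => if x = ι t then (1 : ℝ) else 0)) - effForm H' (Matrix.fromRows (reM (QB N R M)) (fun (t : T) (x : Tor (fine (R * N) M) × Fin d) => if x = ι t then (1 : ℝ) else 0))) b b'| ≤
      4 * (Λ + a) ^ 2 * ((1 : ℝ) ^ 2 * εE * Real.exp (r * 2)) * ((d : ℝ) * (1 + (R : ℝ) ^ d) * Kf (rU' / 2)) ^ 2 * Real.exp (-(rU' / 2 * (tdist ((Sum.elim (fun b : Tor (fine N M) × Fin d => b.1) (fun t : T => par N R M (ι t).1)) b) ((Sum.elim (fun b : Tor (fine N M) × Fin d => b.1) (fun t : T => par N R M (ι t).1)) b') : ℝ))) := by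
  have hcK0 : 0 ≤ cK := by rw [hcK]; positivity
  have hprofF : ∀ s : ℝ, 0 < s → 0 ≤ (d : ℝ) * (R : ℝ) ^ d * Kf s := fun s hs => by have := hKf0 s hs; positivity
  have hprofU : ∀ s : ℝ, 0 < s → 0 ≤ (d : ℝ) * (1 + (R : ℝ) ^ d) * Kf s := fun s hs => by have := hKf0 s hs; positivity
  have hrF0 : 0 < rF := by rw [hrF]; exact rate_pos hprofF hγK hcK0 hδH
  have hr0 : 0 < r := by rw [hr]; positivity
  have hc₀0 : 0 ≤ c₀ := by rw [hc₀]; positivity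
  have hΛ0 : 0 ≤ Λ := by rw [hΛ]; positivity
  have hεE0 : 0 ≤ εE := by rw [hεE]; have := hKf0 (rF / 2) (by positivity); positivity
  have hUB := ub_QB_axial N R M ι (H := H) hι hh hHub
  have hUB' := ub_QB_axial N R M ι (H := H') hι hh hHub'
  simp_rw [← hΛ] at hUB hUB'
  have hP := abs_blockProp_le_QB_axial_half N R M ι hKf0 hKf hH hγK ha hh₀ hδH hK hHent hcK hrF hc₀
  have hP' := abs_blockProp_le_QB_axial_half N R M ι hKf0 hKf hH' hγK ha hh₀ hδH hK' hHent' hcK hrF hc₀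
  simp_rw [← hr] at hP hP'
  have hE := abs_inv_sub_inv_regFormAx_le N R M ι hKf0 hKf hH hH' hγK ha hh₀ hδH hK hK' hHent hHent' hε hdiff hcK hrF
  simp_rw [← hεE, ← hr] at hE
  have hmain := abs_effForm_sub_le_of_soft (Qf := (1 : Matrix (Tor (fine (R * N) M) × Fin d) (Tor (fine (R * N) M) × Fin d) ℝ))
    (ρ := fun b b' : (Tor (fine N M) × Fin d) ⊕ T => (tdist ((Sum.elim (fun b : Tor (fine N M) × Fin d => b.1) (fun t : T => par N R M (ι t).1)) b) ((Sum.elim (fun b : Tor (fine N M) × Fin d => b.1) (fun t : T => par N R M (ι t).1)) b') : ℝ))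
    (D := fun x x' : Tor (fine (R * N) M) × Fin d => (tdist (par N R M x.1) (par N R M x'.1) : ℝ))
    hprofU (isPseudoDist_key N R M ι) (sumBound_key N R M ι hKf) ha hγK hΛ0 hc₀0 hr0 hεE0 le_rfl hH hpsd hK hUB hP hH' hpsd'
    (by simpa only [Matrix.mul_one] using hK') (by simpa only [Matrix.mul_one] using hUB') (by simpa only [Matrix.mul_one] using hP')
    (by simpa only [Matrix.mul_one, Matrix.one_mul, Matrix.transpose_one] using hE)
    (fun b => sum_abs_fromRows_row N R M ι b) (fun b x b' x' hb hb' => tdist_key_le_tdist_par_add_two N R M ι hb hb') b b'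
  rw [← hrU'] at hmain
  simpa only [Matrix.mul_one] using hmain

/-- **`abs_minOp_sub_le_QB_axial` — THE GAUGE-FIXED HARD MINIMISER IS LIPSCHITZ IN THE FINE FORM, COLUMNWISE WITH DECAY** [our proof; PART 113 `abs_avg_minOp_sub_le_of_soft` at `Qf = 1`]:
`|(ℋ′ − ℋ)(x,b)| ≤ (2(Λ+a)·(1·ε_E·e^{r·1}) + 4(Λ+a)²·(d(1+R^d)Kf(r_U′∕2))²·c₁·(1²·ε_E·e^{r·2}))·(d(1+R^d)Kf(m′∕2))·e^{−(m′∕2)·tdist(par x, key b)}`, `m′ = min r (r_U′∕2)`. -/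
theorem abs_minOp_sub_le_QB_axial (hι : ∀ t : T, ¬ (∀ ν, ((rem N R M (ι t).1 ν : ℕ)) = R - 1)) (hKf0 : ∀ s : ℝ, 0 < s → 0 ≤ Kf s)
    (hKf : ∀ s : ℝ, 0 < s → ∀ y : Tor (fine N M), ∑ y' : Tor (fine N M), Real.exp (-(s * (tdist y y' : ℝ))) ≤ Kf s)
    (hH : Hᵀ = H) (hpsd : ∀ z, 0 ≤ z ⬝ᵥ (H *ᵥ z)) (hH' : H'ᵀ = H') (hpsd' : ∀ z, 0 ≤ z ⬝ᵥ (H' *ᵥ z)) {h : ℝ} (hh : 0 ≤ h)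
    (hHub : ∀ u, u ⬝ᵥ (H *ᵥ u) ≤ h * (u ⬝ᵥ u)) (hHub' : ∀ u, u ⬝ᵥ (H' *ᵥ u) ≤ h * (u ⬝ᵥ u)) {γK : ℝ} (hγK : 0 < γK)
    {a h₀ δH : ℝ} (ha : 0 < a) (hh₀ : 0 ≤ h₀) (hδH : 0 < δH)
    (hK : QGQInverse.Coercive (H + (Matrix.fromRows (reM (QB N R M)) (fun (t : T) (x : Tor (fine (R * N) M) × Fin d) => if x = ι t then (1 : ℝ) else 0))ᵀ * (a • (1 : Matrix ((Tor (fine N M) × Fin d) ⊕ T) ((Tor (fine N M) × Fin d) ⊕ T) ℝ)) * Matrix.fromRows (reM (QB N R M)) (fun (t : T) (x : Tor (fine (R * N) M) × Fin d) => if x = ι t then (1 : ℝ) else 0)) γK) (hK' : QGQInverse.Coercive (H' + (Matrix.fromRows (reM (QB N R M)) (fun (t : T) (x : Tor (fine (R * N) M) × Fin d) => if x = ι t then (1 : ℝ) else 0))ᵀ * (a • (1 : Matrix ((Tor (fine N M) × Fin d) ⊕ T) ((Tor (fine N M) × Fin d) ⊕ T) ℝ)) * Matrix.fromRows (reM (QB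 N R M)) (fun (t : T) (x : Tor (fine (R * N) M) × Fin d) => if x = ι t then (1 : ℝ) else 0)) γK)
    (hHent : ∀ x x', |H x x'| ≤ h₀ * Real.exp (-(δH * (tdist (par N R M x.1) (par N R M x'.1) : ℝ))))
    (hHent' : ∀ x x', |H' x x'| ≤ h₀ * Real.exp (-(δH * (tdist (par N R M x.1) (par N R M x'.1) : ℝ)))) {ε : ℝ} (hε : 0 ≤ ε)
    (hdiff : ∀ x x', |(H - H') x x'| ≤ ε * Real.exp (-(δH * (tdist (par N R M x.1) (par N R M x'.1) : ℝ))))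
    {cK rF r c₀ c₁ Λ εE rU' : ℝ} (hcK : cK = (h₀ + a * (((R : ℝ) ^ d)⁻¹ * ((R : ℝ) ^ d)⁻¹) * Real.exp (2 * δH)) + a)
    (hrF : rF = rate (fun s => (d : ℝ) * (R : ℝ) ^ d * Kf s) γK cK δH)
    (hr : r = rF / 2) (hc₀ : c₀ = 2 / γK * Real.exp (2 * rF)) (hc₁ : c₁ = 2 / γK * Real.exp rF) (hΛ : Λ = h * (4 * ((R : ℝ) ^ d) ^ 2 * (1 + ((R : ℝ) ^ d)⁻¹) + 2 * 1))
    (hεE : εE = (2 / γK) ^ 2 * ε * ((d : ℝ) * (R : ℝ) ^ d * Kf (rF / 2)) ^ 2) (hrU' : rU' = rate (fun s => (d : ℝ) * (1 + (R : ℝ) ^ d) * Kf s) (Λ + a)⁻¹ c₀ r)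
    (x : Tor (fine (R * N) M) × Fin d) (b : (Tor (fine N M) × Fin d) ⊕ T) :
    |(minOp H' (Matrix.fromRows (reM (QB N R M)) (fun (t : T) (x : Tor (fine (R * N) M) × Fin d) => if x = ι t then (1 : ℝ) else 0)) - minOp H (Matrix.fromRows (reM (QB N R M)) (fun (t : T) (x : Tor (fine (R * N) M) × Fin d) => if x = ι t then (1 : ℝ) else 0))) x b| ≤
      (2 * (Λ + a) * ((1 : ℝ) * εE * Real.exp (r * 1)) + 4 * (Λ + a) ^ 2 * ((d : ℝ) * (1 + (R : ℝ) ^ d) * Kf (rU' / 2)) ^ 2 * c₁ * ((1 : ℝ) ^ 2 * εE * Real.exp (r * 2))) *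
        ((d : ℝ) * (1 + (R : ℝ) ^ d) * Kf (min r (rU' / 2) / 2)) * Real.exp (-(min r (rU' / 2) / 2 * (tdist (par N R M x.1) ((Sum.elim (fun b : Tor (fine N M) × Fin d => b.1) (fun t : T => par N R M (ι t).1)) b) : ℝ))) := by
  have hcK0 : 0 ≤ cK := by rw [hcK]; positivity
  have hprofF : ∀ s : ℝ, 0 < s → 0 ≤ (d : ℝ) * (R : ℝ) ^ d * Kf s := fun s hs => by have := hKf0 s hs; positivity
  have hprofU : ∀ s : ℝ, 0 < s → 0 ≤ (d : ℝ) * (1 + (R : ℝ) ^ d) * Kf s := fun s hs => by have := hKf0 s hs; positivity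
  have hrF0 : 0 < rF := by rw [hrF]; exact rate_pos hprofF hγK hcK0 hδH
  have hr0 : 0 < r := by rw [hr]; positivity
  have hc₀0 : 0 ≤ c₀ := by rw [hc₀]; positivity
  have hΛ0 : 0 ≤ Λ := by rw [hΛ]; positivity
  have hεE0 : 0 ≤ εE := by rw [hεE]; have := hKf0 (rF / 2) (by positivity); positivity
  have hUB := ub_QB_axial N R M ι (H := H) hι hh hHub
  have hUB' := ub_QB_axial N R M ι (H := H') hι hh hHub'
  simp_rw [← hΛ] at hUB hUB'
  have hP := abs_blockProp_le_QB_axial_half N R M ι hKf0 hKf hH hγK ha hh₀ hδH hK hHent hcK hrF hc₀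
  have hP' := abs_blockProp_le_QB_axial_half N R M ι hKf0 hKf hH' hγK ha hh₀ hδH hK' hHent' hcK hrF hc₀
  simp_rw [← hr] at hP hP'
  have hE := abs_inv_sub_inv_regFormAx_le N R M ι hKf0 hKf hH hH' hγK ha hh₀ hδH hK hK' hHent hHent' hε hdiff hcK hrF
  simp_rw [← hεE, ← hr] at hE
  have hc₁0 : 0 ≤ c₁ := by rw [hc₁]; positivity
  have hT := abs_inv_mul_transpose_le_QB_axial_half N R M ι hKf0 hKf hH hγK ha hh₀ hδH hK hHent hcK hrF hc₁
  simp_rw [← hr] at hT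
  have hmain := abs_avg_minOp_sub_le_of_soft (Qf := (1 : Matrix (Tor (fine (R * N) M) × Fin d) (Tor (fine (R * N) M) × Fin d) ℝ))
    (ρ := fun b b' : (Tor (fine N M) × Fin d) ⊕ T => (tdist ((Sum.elim (fun b : Tor (fine N M) × Fin d => b.1) (fun t : T => par N R M (ι t).1)) b) ((Sum.elim (fun b : Tor (fine N M) × Fin d => b.1) (fun t : T => par N R M (ι t).1)) b') : ℝ))
    (D := fun x x' : Tor (fine (R * N) M) × Fin d => (tdist (par N R M x.1) (par N R M x'.1) : ℝ))
    (σ := fun (x : Tor (fine (R * N) M) × Fin d) (b : (Tor (fine N M) × Fin d) ⊕ T) => (tdist (par N R M x.1) ((Sum.elim (fun b : Tor (fine N M) × Fin d => b.1) (fun t : T => par N R M (ι t).1)) b) : ℝ))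
    hprofU (isPseudoDist_key N R M ι) (sumBound_key N R M ι hKf) ha hγK hΛ0 hc₀0 hr0 hεE0 le_rfl hc₁0 hr0 le_rfl hH hpsd hK hUB hP hH' hpsd'
    (by simpa only [Matrix.mul_one] using hK') (by simpa only [Matrix.mul_one] using hUB') (by simpa only [Matrix.mul_one] using hP')
    (by simpa only [Matrix.mul_one, Matrix.one_mul, Matrix.transpose_one] using hE)
    (fun b => sum_abs_fromRows_row N R M ι b) (fun b x b' x' hb hb' => tdist_key_le_tdist_par_add_two N R M ι hb hb')
    (fun b x x' hb' => tdist_par_key_le_tdist_par_add_one N R M ι x hb')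
    (fun x b => Nat.cast_nonneg _)
    (fun x b b' => by exact_mod_cast tdist_triangle (par N R M x.1) ((Sum.elim (fun b : Tor (fine N M) × Fin d => b.1) (fun t : T => par N R M (ι t).1)) b') ((Sum.elim (fun b : Tor (fine N M) × Fin d => b.1) (fun t : T => par N R M (ι t).1)) b)) hT x b
  rw [← hrU'] at hmain
  simpa only [Matrix.mul_one, Matrix.one_mul] using hmain

/-- **`abs_flucCov_sub_le_QB_axial` — THE GAUGE-FIXED FLUCTUATION COVARIANCE IS LIPSCHITZ IN THE FINE FORM, ENTRYWISE WITH BLOCK DECAY** [our proof; PART 114 `abs_avg_flucCov_sub_le_of_soft` at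
`Qf = 1`]: `|(𝒢′ − 𝒢)(x,x′)| ≤ (ε_E + (A₁·(c₁ + ε₁) + A₂·ε₁)·(d(1+R^d)Kf(m′∕4)))·e^{−(m′∕4)·tdist(par x, par x′)}` with PART 114's `A₁, A₂`, `ε₁ = 1·ε_E·e^{r·1}`, `m′ = min r (r_U′∕2)` — every term
carries a factor `ε`. -/
theorem abs_flucCov_sub_le_QB_axial (hι : ∀ t : T, ¬ (∀ ν, ((rem N R M (ι t).1 ν : ℕ)) = R - 1)) (hKf0 : ∀ s : ℝ, 0 < s → 0 ≤ Kf s)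
    (hKf : ∀ s : ℝ, 0 < s → ∀ y : Tor (fine N M), ∑ y' : Tor (fine N M), Real.exp (-(s * (tdist y y' : ℝ))) ≤ Kf s)
    (hH : Hᵀ = H) (hpsd : ∀ z, 0 ≤ z ⬝ᵥ (H *ᵥ z)) (hH' : H'ᵀ = H') (hpsd' : ∀ z, 0 ≤ z ⬝ᵥ (H' *ᵥ z)) {h : ℝ} (hh : 0 ≤ h)
    (hHub : ∀ u, u ⬝ᵥ (H *ᵥ u) ≤ h * (u ⬝ᵥ u)) (hHub' : ∀ u, u ⬝ᵥ (H' *ᵥ u) ≤ h * (u ⬝ᵥ u)) {γK : ℝ} (hγK : 0 < γK)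
    {a h₀ δH : ℝ} (ha : 0 < a) (hh₀ : 0 ≤ h₀) (hδH : 0 < δH)
    (hK : QGQInverse.Coercive (H + (Matrix.fromRows (reM (QB N R M)) (fun (t : T) (x : Tor (fine (R * N) M) × Fin d) => if x = ι t then (1 : ℝ) else 0))ᵀ * (a • (1 : Matrix ((Tor (fine N M) × Fin d) ⊕ T) ((Tor (fine N M) × Fin d) ⊕ T) ℝ)) * Matrix.fromRows (reM (QB N R M)) (fun (t : T) (x : Tor (fine (R * N) M) × Fin d) => if x = ι t then (1 : ℝ) else 0)) γK) (hK' : QGQInverse.Coercive (H' + (Matrix.fromRows (reM (QB N R M)) (fun (t : T) (x : Tor (fine (R * N) M) × Fin d) => if x = ι t then (1 : ℝ) else 0))ᵀ * (a • (1 : Matrix ((Tor (fine N M) × Fin d) ⊕ T) ((Tor (fine N M) × Fin d) ⊕ T) ℝ)) * Matrix.fromRows (reM (QB N R M)) (fun (t : T) (x : Tor (fine (R * N) M) × Fin d) => if x = ι t then (1 : ℝ) else 0)) γK)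
    (hHent : ∀ x x', |H x x'| ≤ h₀ * Real.exp (-(δH * (tdist (par N R M x.1) (par N R M x'.1) : ℝ))))
    (hHent' : ∀ x x', |H' x x'| ≤ h₀ * Real.exp (-(δH * (tdist (par N R M x.1) (par N R M x'.1) : ℝ)))) {ε : ℝ} (hε : 0 ≤ ε)
    (hdiff : ∀ x x', |(H - H') x x'| ≤ ε * Real.exp (-(δH * (tdist (par N R M x.1) (par N R M x'.1) : ℝ))))
    {cK rF r c₀ c₁ Λ εE rU' : ℝ} (hcK : cK = (h₀ + a * (((R : ℝ) ^ d)⁻¹ * ((R : ℝ) ^ d)⁻¹) * Real.exp (2 * δH)) + a)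
    (hrF : rF = rate (fun s => (d : ℝ) * (R : ℝ) ^ d * Kf s) γK cK δH)
    (hr : r = rF / 2) (hc₀ : c₀ = 2 / γK * Real.exp (2 * rF)) (hc₁ : c₁ = 2 / γK * Real.exp rF) (hΛ : Λ = h * (4 * ((R : ℝ) ^ d) ^ 2 * (1 + ((R : ℝ) ^ d)⁻¹) + 2 * 1))
    (hεE : εE = (2 / γK) ^ 2 * ε * ((d : ℝ) * (R : ℝ) ^ d * Kf (rF / 2)) ^ 2) (hrU' : rU' = rate (fun s => (d : ℝ) * (1 + (R : ℝ) ^ d) * Kf s) (Λ + a)⁻¹ c₀ r)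
    (x x' : Tor (fine (R * N) M) × Fin d) :
    |(flucCov H' (Matrix.fromRows (reM (QB N R M)) (fun (t : T) (x : Tor (fine (R * N) M) × Fin d) => if x = ι t then (1 : ℝ) else 0)) - flucCov H (Matrix.fromRows (reM (QB N R M)) (fun (t : T) (x : Tor (fine (R * N) M) × Fin d) => if x = ι t then (1 : ℝ) else 0))) x x'| ≤
      (εE + ((2 * (Λ + a) * ((1 : ℝ) * εE * Real.exp (r * 1)) +
              4 * (Λ + a) ^ 2 * ((d : ℝ) * (1 + (R : ℝ) ^ d) * Kf (rU' / 2)) ^ 2 * c₁ * ((1 : ℝ) ^ 2 * εE * Real.exp (r * 2))) *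
            ((d : ℝ) * (1 + (R : ℝ) ^ d) * Kf (min r (rU' / 2) / 2)) * (c₁ + (1 : ℝ) * εE * Real.exp (r * 1)) +
          2 * (Λ + a) * c₁ * ((d : ℝ) * (1 + (R : ℝ) ^ d) * Kf (min r rU' / 2)) * ((1 : ℝ) * εE * Real.exp (r * 1))) *
        ((d : ℝ) * (1 + (R : ℝ) ^ d) * Kf (min r (rU' / 2) / 4))) *
        Real.exp (-(min r (rU' / 2) / 4 * (tdist (par N R M x.1) (par N R M x'.1) : ℝ))) := by
  have hcK0 : 0 ≤ cK := by rw [hcK]; positivity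
  have hprofF : ∀ s : ℝ, 0 < s → 0 ≤ (d : ℝ) * (R : ℝ) ^ d * Kf s := fun s hs => by have := hKf0 s hs; positivity
  have hprofU : ∀ s : ℝ, 0 < s → 0 ≤ (d : ℝ) * (1 + (R : ℝ) ^ d) * Kf s := fun s hs => by have := hKf0 s hs; positivity
  have hrF0 : 0 < rF := by rw [hrF]; exact rate_pos hprofF hγK hcK0 hδH
  have hr0 : 0 < r := by rw [hr]; positivity
  have hc₀0 : 0 ≤ c₀ := by rw [hc₀]; positivity
  have hΛ0 : 0 ≤ Λ := by rw [hΛ]; positivity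
  have hεE0 : 0 ≤ εE := by rw [hεE]; have := hKf0 (rF / 2) (by positivity); positivity
  have hUB := ub_QB_axial N R M ι (H := H) hι hh hHub
  have hUB' := ub_QB_axial N R M ι (H := H') hι hh hHub'
  simp_rw [← hΛ] at hUB hUB'
  have hP := abs_blockProp_le_QB_axial_half N R M ι hKf0 hKf hH hγK ha hh₀ hδH hK hHent hcK hrF hc₀
  have hP' := abs_blockProp_le_QB_axial_half N R M ι hKf0 hKf hH' hγK ha hh₀ hδH hK' hHent' hcK hrF hc₀
  simp_rw [← hr] at hP hP'
  have hE := abs_inv_sub_inv_regFormAx_le N R M ι hKf0 hKf hH hH' hγK ha hh₀ hδH hK hK' hHent hHent' hε hdiff hcK hrF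
  simp_rw [← hεE, ← hr] at hE
  have hc₁0 : 0 ≤ c₁ := by rw [hc₁]; positivity
  have hT := abs_inv_mul_transpose_le_QB_axial_half N R M ι hKf0 hKf hH hγK ha hh₀ hδH hK hHent hcK hrF hc₁
  simp_rw [← hr] at hT
  have hmain := abs_avg_flucCov_sub_le_of_soft (Qf := (1 : Matrix (Tor (fine (R * N) M) × Fin d) (Tor (fine (R * N) M) × Fin d) ℝ))
    (ρ := fun b b' : (Tor (fine N M) × Fin d) ⊕ T => (tdist ((Sum.elim (fun b : Tor (fine N M) × Fin d => b.1) (fun t : T => par N R M (ι t).1)) b) ((Sum.elim (fun b : Tor (fine N M) × Fin d => b.1) (fun t : T => par N R M (ι t).1)) b') : ℝ))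
    (D := fun x x' : Tor (fine (R * N) M) × Fin d => (tdist (par N R M x.1) (par N R M x'.1) : ℝ))
    (σ := fun (x : Tor (fine (R * N) M) × Fin d) (b : (Tor (fine N M) × Fin d) ⊕ T) => (tdist (par N R M x.1) ((Sum.elim (fun b : Tor (fine N M) × Fin d => b.1) (fun t : T => par N R M (ι t).1)) b) : ℝ))
    (Kσ := (fun s => (d : ℝ) * (1 + (R : ℝ) ^ d) * Kf s))
    hprofU (isPseudoDist_key N R M ι) (sumBound_key N R M ι hKf) ha hγK hΛ0 hc₀0 hr0 hεE0 le_rfl hc₁0 hr0 le_rfl hH hpsd hK hUB hP hH' hpsd'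
    (by simpa only [Matrix.mul_one] using hK') (by simpa only [Matrix.mul_one] using hUB') (by simpa only [Matrix.mul_one] using hP')
    (by simpa only [Matrix.mul_one, Matrix.one_mul, Matrix.transpose_one] using hE)
    zero_le_one (fun b => sum_abs_fromRows_row N R M ι b) (fun b x b' x' hb hb' => tdist_key_le_tdist_par_add_two N R M ι hb hb')
    (fun b x x' hb' => tdist_par_key_le_tdist_par_add_one N R M ι x hb')
    (fun x b => Nat.cast_nonneg _)
    (fun x b b' => by exact_mod_cast tdist_triangle (par N R M x.1) ((Sum.elim (fun b : Tor (fine N M) × Fin d => b.1) (fun t : T => par N R M (ι t).1)) b') ((Sum.elim (fun b : Tor (fine N M) × Fin d => b.1) (fun t : T => par N R M (ι t).1)) b)) hT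
    (fun x x' => Nat.cast_nonneg _)
    (fun x x' b => by
      have h1 := tdist_triangle (par N R M x.1) ((Sum.elim (fun b : Tor (fine N M) × Fin d => b.1) (fun t : T => par N R M (ι t).1)) b) (par N R M x'.1)
      rw [tdist_comm ((Sum.elim (fun b : Tor (fine N M) × Fin d => b.1) (fun t : T => par N R M (ι t).1)) b) (par N R M x'.1)] at h1
      exact_mod_cast h1)
    (fun s hs x => sum_exp_sigma_key_le N R M ι hKf hs x) x x'
  rw [← hrU'] at hmain
  simpa only [Matrix.mul_one, Matrix.one_mul, Matrix.transpose_one] using hmain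

end Ends

end Summit.QuantumFields.BalabanUV.Beta.GAN24.OneStepConstraintAxialRate

end
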